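import Summits.ABC.IUTFork.LanaEtaLimDictionary
import Summits.ABC.IUTFork.LanaPadicGalois
import Literature.IUT.HodgeArakelov.EtaleThetaDataOfSettingConjStable
import HarnessLib

/-!
# L-LANA dictionary, genuine record: LANA's Fig. 3 étale side over layer L6's `Π^tp_X̲̲` with `θ(Π_v)` from L6's
# `θ(Π)` and `O^▷ = {|·|_p ≤ 1}` IS a [IUTchII] Prop. 3.1 `ThetaEnvData` whose conjugation clauses HOLD — one
# hypothesis left: the synchronization `c` is bijective

Record-only sequel (D-0012; seat abc-iut-c312-4 gen 7, L-LANA level, plan/LLANA-SPEC N14 Steps 2–3 ↔ layer L6) of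
`LanaEtaLimDictionary.lean` (gen 7: `thetaInfSet_eq_image_of_thetaClasses_eq`, `EtaLimSide.toThetaEnvData`,
`conj_permutes_of_stable`; its v2 §3 has the generic model-of-record forms `…_model'`). TAKES NO SIDE on [IUTchIII] Cor. 3.12. LANA §6.2 (d) p. 34: "We then write `M^Θ_{v,∞} :=
O^×_v(Π_v) · ∞θ(Π_v)` … Here `O^×_v(Π_v)` is an étale-like copy of `O^×_v` reconstructed from `Π_v`"; §3.5 p. 19 (the
Galois action on `K̄_v` preserves `| · |`). [cite: LANA2026Report, §6.2 (d) p. 34, §3.5 p. 19]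
[IUTchII] Prop. 3.1 (i) p. 87 / (ii) p. 88 ("equipped with a natural conjugation action by `Π_X(M^Θ_*)`"), as typed by
abc-iut-L6-t2 (`TemperedThetaMonoids.ThetaEnvData`, `IsConjStable`, `Prop31Statements.conj_permutes` shape).
[cite: Mochizuki2012, Prop 3.1 p.87]

HERE the dictionary is instantiated at the GENUINE record `genuineRecord`: gen 5's `EtaLimSide.ofDoubleUnderline`
(genuine `Π^tp_X̲̲`, `Π^tp_Ÿ̲̲`, `l·Δ_Θ`, `ℚ̄_pˣ`, any synchronization `c`) with `θ(Π_v) :=` the image in the limit of the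
`θ(Π)` of abc-iut-L6's model of record `etaleThetaDataOfSetting'`, `O^▷ := {|·|_p ≤ 1}`, `O^× := {|·|_p = 1}` (gen 0
`padicVal`). The inputs of gen 7's `conj_permutes_of_stable` become THEOREMS (stability of `θ(Π_v)`: abc-iut-w4-d030
`image_h1LimConjEquiv_toLim_theta`, read multiplicatively): `κ_H` injective for bijective `c`
(abc-iut-w4-d007 `h1LimKummer_injective_of_coeff`), `O^× = (O^▷)^×` (`mem_unitGrp_of_mem_intMonoidUnits_of_inv_mem`),
`O^×` and `O^▷` stable under `Π^tp_X̲̲` (the action is through `ε` and Galois automorphisms are ISOMETRIES — gen 0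
`isValPreserving_padic`). RESULTS, hypothesis "`c` bijective" ONLY: `genuineRecord_thetaInfSet` (its `∞θ(Π_v)` IS
[IUTchII] Prop. 1.4's `∞θ(Π)`), `genuineRecord_constantMonoid_isConjStable` (Prop. 3.1 (ii)'s conjugation action on
`Ψ_cns = κ_H(O^▷)`), **`genuineRecord_conj_permutes`** (Prop. 3.1 (i)'s conjugation clause for
`Ψ_env = O^×(Π_v)·⟨θ(Π_v)⟩`). HONEST SCOPE: dictionary/instantiation only; Prop. 3.1 (i)'s "splitting up to torsion" and
(ii)'s "naturally isomorphic to `O^▷_{F̄_v}`" beyond injectivity of `κ_H` are not claimed here. NOT here: any judgement.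
-/

noncomputable section

namespace Summit.ABC
namespace IUTFork

open Literature.AnabelianGeometry.EtaleTheta
open Literature.IUT.HodgeArakelov
open Literature.IUT.HodgeArakelov.CohomologySystemOfContH1

/-! ## 1. `O^× = (O^▷)^×` and isometry of the Galois action -/

section Valued

variable {K : Type} [Field K] {Γ₀ : Type} [LinearOrderedCommGroupWithZero Γ₀] (w : Valuation K Γ₀)

/-- **`O^× = (O^▷)^×` for the valuation data**: `|a| ≤ 1` and `|a⁻¹| ≤ 1` force `|a| = 1` (the input `hunits` of
`toThetaEnvData`). [cite: LANA2026Report, §0.4 (b) p. 8] -/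
theorem mem_unitGrp_of_mem_intMonoidUnits_of_inv_mem (a : Kˣ) (ha : a ∈ intMonoidUnits w)
    (ha' : a⁻¹ ∈ intMonoidUnits w) : a ∈ unitGrp w := by
  rw [mem_intMonoidUnits_iff] at ha ha'
  rw [Units.val_inv_eq_inv_val, map_inv₀] at ha'
  have h0 : 0 < w (a : K) := (Valuation.pos_iff w).mpr a.ne_zero
  exact (mem_unitGrp_iff w a).mpr (le_antisymm ha ((inv_le_one₀ h0).mp ha'))

end Valued

/-! ## 2. The genuine record -/

section Genuine

open Literature.IUT.HodgeArakelov.EtaleThetaDataOfSetting Literature.IUT.HodgeArakelov.TemperedThetaMonoids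

variable {p : ℕ} [Fact p.Prime] {D : Literature.AnabelianGeometry.EtaleTheta.ThetaSetting p}
  {E : D.EtaleThetaData} {l : ℕ} (C : E.DoubleUnderline l) (hC : D.Compat) (hS : D.Sec2Hyps)
  (hchar : PiYddCharacteristic C) (Sset : Literature.IUT.HodgeArakelov.ThetaSetting.{0})
  (eS : (Pi C) ≃ₜ* Sset.PiX) (hl : Sset.l = l) [TopologicalSpace (PadicAlgCl p)ˣ]

omit [TopologicalSpace (PadicAlgCl p)ˣ] in
/-- The action of `Π^tp_X̲̲` on `ℚ̄_pˣ` (through `ε`, abc-iut-w4-d007 `unitsAction`) is ISOMETRIC for `|·|_p`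
(gen 0 `isValPreserving_padic`: Galois automorphisms preserve the spectral norm).
[cite: LANA2026Report, §3.5 p. 19] -/
theorem padicVal_units_smul (g : Pi C) (a : (PadicAlgCl p)ˣ) :
    padicVal p ((g • a : (PadicAlgCl p)ˣ) : PadicAlgCl p) = padicVal p (a : PadicAlgCl p) := by
  rw [units_coe_smul]
  exact IsValPreserving.val_smul (w := padicVal p) (aug C g) (a : PadicAlgCl p)

omit [TopologicalSpace (PadicAlgCl p)ˣ] in
/-- `O^× = {|·|_p = 1} ⊆ ℚ̄_pˣ` is stable under `Π^tp_X̲̲`. [cite: LANA2026Report, §3.5 p. 19] -/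
theorem smul_mem_unitGrp_padicVal (g : Pi C) (a : (PadicAlgCl p)ˣ) (ha : a ∈ unitGrp (padicVal p)) :
    g • a ∈ unitGrp (padicVal p) := by
  rw [mem_unitGrp_iff] at ha ⊢
  rw [padicVal_units_smul, ha]

omit [TopologicalSpace (PadicAlgCl p)ˣ] in
/-- `O^▷ = {|·|_p ≤ 1} ⊆ ℚ̄_pˣ` is stable under `Π^tp_X̲̲`. [cite: LANA2026Report, §3.5 p. 19] -/
theorem smul_mem_intMonoidUnits_padicVal (g : Pi C) (a : (PadicAlgCl p)ˣ)
    (ha : a ∈ intMonoidUnits (padicVal p)) : g • a ∈ intMonoidUnits (padicVal p) := by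
  rw [mem_intMonoidUnits_iff] at ha ⊢
  rw [padicVal_units_smul]
  exact ha

variable (c : CyclotomeCoefficients (phi C) (D.lDeltaTheta l) (PadicAlgCl p)ˣ)

/-- **The genuine record of this dictionary**: gen 5's `ofDoubleUnderline` (genuine `Π^tp_X̲̲`, `Π^tp_Ÿ̲̲`, `l·Δ_Θ`,
`ℚ̄_pˣ`, synchronization `c`) with `θ(Π_v) :=` the image in the limit of the `θ(Π)` of abc-iut-L6's model of record
`etaleThetaDataOfSetting'` ((6-1) ↔ [IUTchII] Prop. 1.4), `O^▷ := {|·|_p ≤ 1}`, `O^× := {|·|_p = 1}`, theta value `q`.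
[cite: LANA2026Report, §6.2 (c)–(d) p. 34] [cite: Mochizuki2012, Prop 1.4 p.27] -/
def genuineRecord (q : intMonoidUnits (padicVal p)) :
    EtaLimSide (phi C) (D.lDeltaTheta l) (PiYdd C) (PadicAlgCl p)ˣ :=
  EtaLimSide.ofDoubleUnderline C c
    (Multiplicative.ofAdd '' ((coh C).toLim ⊤ '' (etaleThetaDataOfSetting' C hC hS hchar Sset eS hl).theta))
    (intMonoidUnits (padicVal p)) (unitGrp (padicVal p)) (unitGrp_le_intMonoidUnits _) q

/-- Its `θ(Π_v)` is the image in the limit of L6's `θ(Π)` (by construction). [cite: Mochizuki2012, Prop 1.4 p.27] -/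
theorem genuineRecord_thetaClasses (q : intMonoidUnits (padicVal p)) :
    (genuineRecord C hC hS hchar Sset eS hl c q).thetaClasses =
      Multiplicative.ofAdd '' ((coh C).toLim ⊤ '' (etaleThetaDataOfSetting' C hC hS hchar Sset eS hl).theta) := rfl

/-- **Its `∞θ(Π_v)` IS [IUTchII] Prop. 1.4's `∞θ(Π)`** of L6's model of record. [cite: LANA2026Report, §6.2 (d) p. 34]
[cite: Mochizuki2012, Prop 1.4 p.27] -/
theorem genuineRecord_thetaInfSet (q : intMonoidUnits (padicVal p)) :
    (genuineRecord C hC hS hchar Sset eS hl c q).thetaInfSet =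
      Multiplicative.ofAdd '' (etaleThetaDataOfSetting' C hC hS hchar Sset eS hl).thetaInfty := by
  rw [(genuineRecord C hC hS hchar Sset eS hl c q).thetaInfSet_eq_image_of_thetaClasses_eq _ rfl]
  congr 1
  ext x
  constructor
  · rintro ⟨n, hn, t, ⟨t₀, ht₀, rfl⟩, hfin⟩
    exact ⟨n, hn, t₀, ht₀, hfin⟩
  · rintro ⟨n, hn, t₀, ht₀, hfin⟩
    exact ⟨n, hn, _, ⟨t₀, ht₀, rfl⟩, hfin⟩

/-- `κ_H` of the genuine record is injective for a bijective synchronization (abc-iut-w4-d007: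
`[G_{ℚ_p} : ε(Π^tp_Ÿ̲̲)] < ∞`). [cite: Mochizuki2012, Cor 1.12 p.56] -/
theorem genuineRecord_kappaH_injective (hc : Function.Bijective c.hom) (q : intMonoidUnits (padicVal p)) :
    Function.Injective (genuineRecord C hC hS hchar Sset eS hl c q).kappaH :=
  h1LimKummer_injective_of_coeff C (phi C) (D.lDeltaTheta l) c (PiYdd C) hc

omit [TopologicalSpace (PadicAlgCl p)ˣ] in
/-- `O^× = (O^▷)^×` for the genuine integral structure. [cite: LANA2026Report, §0.4 (b) p. 8] -/
theorem genuine_hunits (a : (PadicAlgCl p)ˣ) (ha : a ∈ intMonoidUnits (padicVal p))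
    (ha' : a⁻¹ ∈ intMonoidUnits (padicVal p)) : a ∈ unitGrp (padicVal p) :=
  mem_unitGrp_of_mem_intMonoidUnits_of_inv_mem _ a ha ha'

/-- **[IUTchII] Prop. 3.1 (ii)'s "natural conjugation action" on `Ψ_cns = κ_H(O^▷)` at the genuine record**, with
the single hypothesis "`c` bijective". [cite: Mochizuki2012, Prop 3.1 (ii) p.88] -/
theorem genuineRecord_constantMonoid_isConjStable (hc : Function.Bijective c.hom)
    (q : intMonoidUnits (padicVal p)) :
    haveI := piYdd_normal C hC
    ((genuineRecord C hC hS hchar Sset eS hl c q).toThetaEnvData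
        (genuineRecord_kappaH_injective C hC hS hchar Sset eS hl c hc q) (genuine_hunits (p := p))).IsConjStable
      ((genuineRecord C hC hS hchar Sset eS hl c q).toThetaEnvData
        (genuineRecord_kappaH_injective C hC hS hchar Sset eS hl c hc q) (genuine_hunits (p := p))).constantMonoid :=
  haveI := piYdd_normal C hC
  (genuineRecord C hC hS hchar Sset eS hl c q).toThetaEnvData_constantMonoid_isConjStable _ _
    (smul_mem_intMonoidUnits_padicVal C)

/-- **[IUTchII] Prop. 3.1 (i)'s "natural conjugation action" clause at the genuine record** — LANA's Fig. 3 étale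
side over the genuine `Π^tp_X̲̲` with `θ(Π_v)` from L6's `θ(Π)` and `O^▷ = {|·|_p ≤ 1}`, read as L6-t2's
`ThetaEnvData`: each `g ∈ Π^tp_X̲̲` carries `Ψ_env = O^×(Π_v)·⟨θ(Π_v)⟩` onto itself — with the SINGLE hypothesis
"`c` bijective" (everything else: w4-d007 injectivity, w4-d030 stability of `θ(Π)`, gen 0 isometry).
[cite: Mochizuki2012, Prop 3.1 (i) p.87] [cite: LANA2026Report, §6.2 (d) p. 34] -/
theorem genuineRecord_conj_permutes (hc : Function.Bijective c.hom) (q : intMonoidUnits (padicVal p))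
    (g : Pi C) (ι : PUnit) :
    haveI := piYdd_normal C hC
    ∃ ι' : PUnit, (((genuineRecord C hC hS hchar Sset eS hl c q).toThetaEnvData
        (genuineRecord_kappaH_injective C hC hS hchar Sset eS hl c hc q) (genuine_hunits (p := p))).thetaMonoid ι).map
      (((genuineRecord C hC hS hchar Sset eS hl c q).toThetaEnvData
        (genuineRecord_kappaH_injective C hC hS hchar Sset eS hl c hc q) (genuine_hunits (p := p))).conj g).toMonoidHom =
      ((genuineRecord C hC hS hchar Sset eS hl c q).toThetaEnvData
        (genuineRecord_kappaH_injective C hC hS hchar Sset eS hl c hc q) (genuine_hunits (p := p))).thetaMonoid ι' := by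
  haveI := piYdd_normal C hC
  refine (genuineRecord C hC hS hchar Sset eS hl c q).conj_permutes_of_stable _ _ (smul_mem_unitGrp_padicVal C)
    (fun g => ?_) g ι
  -- `θ(Π_v) = ofAdd '' (toLim ⊤ '' θ(Π))` is conjugation-stable: abc-iut-w4-d030, read multiplicatively
  have key := image_h1LimConjEquiv_toLim_theta C hC hS hchar Sset eS hl g
  have hT : ∀ T : Set (coh C).lim,
      (h1LimConjMulAut (phi C) (D.lDeltaTheta l) (PiYdd C) g) '' (Multiplicative.ofAdd '' T) =
        Multiplicative.ofAdd '' (h1LimConjEquiv (phi C) (D.lDeltaTheta l) (PiYdd C) g '' T) := by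
    intro T
    ext y
    constructor
    · rintro ⟨_, ⟨x, hx, rfl⟩, rfl⟩
      exact ⟨_, ⟨x, hx, rfl⟩, rfl⟩
    · rintro ⟨_, ⟨x, hx, rfl⟩, rfl⟩
      exact ⟨_, ⟨x, hx, rfl⟩, rfl⟩
  rw [genuineRecord_thetaClasses]
  exact (hT _).trans (congrArg (fun T => (Multiplicative.ofAdd '' T : Set (Multiplicative (coh C).lim))) key)

end Genuine

end IUTFork

end Summit.ABC

end
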